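import Summits.BirchSwinnertonDyer.BirchSwinnertonDyer.Theorems.SignedLowerHalvesSmallImageLowerHalfBothSignsRttD2SeqJ3HS2Plumb
import HarnessLib

/-!
# Route `SignedLowerHalves`, crux L `SmallImageLowerHalfBothSigns` (stmt-BirchSwinnertonDyer-23599), line `rtt_w3` v23 — E2, row S2 `stub_junctionExact_ns`:
# ★★★ THE BY-NAME PASTE — v23's `CharRoadExact` BODY (every perfect `λ`, every pinned `jv`) PROVED ON Γ's BINDERS

WIDTH seat `bsd-line-slh-p3-w3` g25 under LEAD `cruxlead-stmt-BirchSwinnertonDyer-23599` g13 (cell `bsd-ssimc`); helper `--supports stmt-BirchSwinnertonDyer-23599`.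
ONE THEOREM (no definition, no named fact, no instance, no `sorry`): `forall_lamPerfect_exact_junctionMap_comp_subtype_cofree_frame` — g24's H7f
`exact_junctionMap_comp_subtype_cofree_lam_of_lamPerfect` (p804012) with every frame hypothesis discharged by §1 of `…RttD2SeqJ3HS2Plumb` (p809825), and the conclusion spelled
EXACTLY as the body of the v23 line-file definition `CharRoadExact hp hκ hK2 hnd S hS θ W j ε hγK S₀ Dψ vp hv 𝔣 hθ'θ hNP I` (LEAD g13, Lines/rtt_w3.lean 2026-08-31T04:09Z) with
the line-file def `JunctionCarrier` unfolded to `strictCarrier I (strictLevel …) _` (definitionally equal). HONEST FRAMING: bookkeeping; row S2 is -w3's J3 theorem (g22–g24);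
E2, crux L, crux M, BSD remain OPEN and are proved for NO curve.

References: [Kobayashi2003] Thm. 7.3 i); [Rubin2000] Thm. 1.7.3, §4.2; [NeukirchSchmidtWingberg2008] VIII §3, §6; [Kato2004Asterisque] §17.13; [Washington1997] Prop. 13.2.
-/

set_option autoImplicit false
set_option linter.dupNamespace false -- D-0017: single-problem summit, the namespace repeats the problem name by design
noncomputable section

open scoped Classical
open NumberField IsDedekindDomain Field Matrix CategoryTheory Function Rat.HeightOneSpectrum

namespace Summit.BirchSwinnertonDyer.BirchSwinnertonDyer.Theorems.SmallImageRttD2Seq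

open Literature.NumberTheory.EllipticCurves Literature.NumberTheory.EllipticCurves.GreenbergSelmer Literature.NumberTheory.GaloisRepresentations
  Literature.NumberTheory.GaloisRepresentations.DiscreteGaloisModule Literature.NumberTheory.GaloisCohomology
  Literature.NumberTheory.EllipticCurves.GreenbergVatsal2000 Literature.NumberTheory.ComplexMultiplication.EllipticUnits.JohnsonLeungKings2011
  Summit.BirchSwinnertonDyer.BirchSwinnertonDyer.Theorems.SmallImageCharSignedSelmer Summit.BirchSwinnertonDyer.BirchSwinnertonDyer.Theorems.SmallImageRttD2J1
  Summit.BirchSwinnertonDyer.BirchSwinnertonDyer.Theorems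

set_option maxHeartbeats 1000000 in
/-- ★★★ **S2 = v23's `CharRoadExact` BODY, ON Γ's BINDERS (the by-name paste for `stub_junctionExact_ns`).** For EVERY `ℤ_p`-linear `λ : 𝒪 → ℤ_p` perfect at every level
(`hlamInj`/`hlamSurj`), every inert-place datum `(γv, DQ, instX, instQ, hιX, hιQ, hCX, hCQ, hγB)` and every `jv : I.H →ₗ[Λ_𝒪] DQ.X` pinned by the `λ`-tower pairing,
`Function.Exact (jv ∘ₗ B′.subtype) gX` on `B′ = strictCarrier I (strictLevel S κ_K θ′ (supp p𝔣) S₀K)` (= the line file's `JunctionCarrier`, unfolded). Inputs = Γ's binders only: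
`htc`, `hnd`, `hκ`, `hS₀p`, `hS₀bad`, `hbad`, `hθ` (unramified off `p𝔪`), `hv`, `𝔣 ≠ ⊥`, the frame conjunct `θ′·θ₀₀ = 1`, (R)/(U) of `CharRoadFrameSupp`, `hNP`. H7f (p804012) + §1 of
`…J3HS2Plumb` (p809825). The statement after the binders is v23's `CharRoadExact hp hκ hK2 hnd S hS θ W j ε hγK S₀ Dψ vp hv 𝔣 hθ'θ hNP I` VERBATIM with `JunctionCarrier` unfolded, so
`stub_junctionExact_ns := fun … hframe hsupp hθ'θ hNP I ↦ forall_lamPerfect_exact_junctionMap_comp_subtype_cofree_frame … hθ'θ hsupp.1 hsupp.2 hNP I`.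
[cite: Kobayashi2003, Thm. 7.3 i)] [cite: Rubin2000, Thm. 1.7.3, §4.2] [cite: NeukirchSchmidtWingberg2008, VIII §6, (7.2.6)] [cite: Kato2004Asterisque, §17.13] [cite: Washington1997, Prop. 13.2] -/
theorem forall_lamPerfect_exact_junctionMap_comp_subtype_cofree_frame
    {p : ℕ} [Fact p.Prime] (hp : p ≠ 2) {κ : ZpExtension ℚ p} (hκ : κ.IsCyclotomic)
    {K : Type} [Field K] [NumberField K] (hK2 : Module.finrank ℚ K = 2) (htc : IsTotallyComplex K) (hnd : ¬ (p : ℤ) ∣ NumberField.discr K)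
    (S : Set (PadicAlgCl p)) (hS : 0 < Module.finrank ℚ_[p] (padicCoeffField S)) (θ : FramedGaloisRep K (padicCoeffIntegers S) 1) (W : WeierstrassCurve ℚ)
    (j : (W.baseChange K).geomPrimaryTorsion p →+ Cofree θ (padicCoeffField S)) (ε : ℤˣ)
    {γK : absoluteGaloisGroup K} (hγK : (κ.restrictOfFinrankEqTwo hp K hK2).IsTopGenerator γK)
    (S₀ : Finset (HeightOneSpectrum (𝓞 ℚ))) (hS₀p : ∀ v ∈ S₀, ((p : ℕ) : 𝓞 ℚ) ∉ v.asIdeal)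
    (hS₀bad : ∀ v : HeightOneSpectrum (𝓞 ℚ), ¬ W.HasGoodReductionAt v → v ∈ S₀) {𝔪 : Ideal (𝓞 K)}
    (hbad : ∀ (ℓ : ℕ) [Fact ℓ.Prime], ℓ ∣ (NumberField.discr K).natAbs * Ideal.absNorm 𝔪 → ¬ W.HasGoodReductionAtPrime ℓ)
    (hθunr : ∀ w : HeightOneSpectrum (𝓞 K), (p : 𝓞 K) ∉ w.asIdeal → ¬ 𝔪 ≤ w.asIdeal → FramedGaloisRep.IsUnramifiedAt w θ)
    (Dψ : SignedTransportDualDataSat (κ.restrictOfFinrankEqTwo hp K hK2) γK (Cofree θ (padicCoeffField S)) (padicCoeffIntegers S) (W.baseChange K) j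
      {w : HeightOneSpectrum (𝓞 K) | ∃ v ∈ S₀, ((natGenerator v : ℕ) : 𝓞 K) ∈ w.asIdeal} ε)
    (vp : HeightOneSpectrum (𝓞 K)) (hv : vp.asIdeal = Ideal.span {((p : ℕ) : 𝓞 K)})
    {θ' : absoluteGaloisGroup K →ₜ* (padicCoeffIntegers S)ˣ} {𝔣 : Ideal (𝓞 K)} (h𝔣 : 𝔣 ≠ ⊥)
    (hθ'θ : ∀ g : absoluteGaloisGroup K, ((θ' g : (padicCoeffIntegers S)ˣ) : padicCoeffIntegers S) *
      ((θ g : GL (Fin 1) (padicCoeffIntegers S)) : Matrix (Fin 1) (Fin 1) (padicCoeffIntegers S)) 0 0 = 1)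
    (hR : ∀ w ∈ suppPF p 𝔣, ((p : ℕ) : 𝓞 K) ∉ w.asIdeal → ∃ 𝔓 ∈ w.primesAbove, ∃ τ ∈ 𝔓.inertia (absoluteGaloisGroup K), θ' τ ≠ 1)
    (hU : ∀ w : HeightOneSpectrum (𝓞 K), w ∉ suppPF p 𝔣 → ∀ 𝔓 ∈ w.primesAbove, ∀ τ ∈ 𝔓.inertia (absoluteGaloisGroup K), θ' τ = 1)
    (hNP : ∀ n : ℕ, ramificationSubgroup K (suppPF p 𝔣) ≤ (κ.restrictOfFinrankEqTwo hp K hK2).layerSubgroup n)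
    (I : CycIwasawaCohomologyDataO S (κ.restrictOfFinrankEqTwo hp K hK2) γK⁻¹ θ' (suppPF p 𝔣) 1) :
  letI := SmallImageRttD2Seq.localAction (closureEmb (K := K) (vp.adicCompletion K)) (GreenbergSelmer.Cofree θ (padicCoeffField S))
  haveI := SmallImageRttD2Seq.smulCommClass_localAction (R := padicCoeffIntegers S) (GreenbergSelmer.Cofree θ (padicCoeffField S)) vp
  letI : Algebra (IwasawaAlgebra p) (IwasawaAlgebraO S) := (iwasawaToIwasawaO S).toAlgebra
  haveI : FiniteDimensional ℚ_[p] (padicCoeffField S) := Module.finite_of_finrank_pos hS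
  letI := I.moduleIwasawa
  haveI := I.isScalarTower_moduleIwasawa
  ∀ (lam : ↥(padicCoeffIntegers S) →+ ℤ_[p]) (hlam : ∀ (c : ℤ_[p]) (y : ↥(padicCoeffIntegers S)), lam (padicIntToCoeffIntegers S c * y) = c * lam y),
    (∀ (m : ℕ) (t : ↥(padicCoeffIntegers S)), (∀ b : ↥(padicCoeffIntegers S), SmallImageRttD2Seq.lamZMod S lam m (b * t) = 0) →
      t ∈ Ideal.span {((p : ℕ) : ↥(padicCoeffIntegers S)) ^ m}) →
    (∀ (m : ℕ) (g : ↥(padicCoeffIntegers S) →+ ZMod (p ^ m)), ∃ t : ↥(padicCoeffIntegers S), ∀ b : ↥(padicCoeffIntegers S), g b = SmallImageRttD2Seq.lamZMod S lam m (b * t)) →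
  ∀ (γv : absoluteGaloisGroup (vp.adicCompletion K))
    (hγv : (κ.restrictOfFinrankEqTwo hp K hK2).IsTopGenerator (resGalOfEmb (closureEmb (K := K) (vp.adicCompletion K)) γv))
    (DQ : SmallImageRttD2Seq.LocalCondDualData (κ.restrictOfFinrankEqTwo hp K hK2) (GreenbergSelmer.Cofree θ (padicCoeffField S)) ↥(padicCoeffIntegers S) (W.baseChange K) j ε vp γv)
    (instX : Module (IwasawaAlgebraO S) Dψ.X) (instQ : Module (IwasawaAlgebraO S) DQ.X)
    (hιX : ∀ (f : IwasawaAlgebra p) (x : Dψ.X), (letI := instX; iwasawaToIwasawaO S f • x) = f • x)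
    (hιQ : ∀ (f : IwasawaAlgebra p) (x : DQ.X), (letI := instQ; iwasawaToIwasawaO S f • x) = f • x)
    (hCX : ∀ (a₁ : ↥(padicCoeffIntegers S)) (x : Dψ.X)
        (s₁ : SmallImageCharSignedSelmer.signedTransportSelmerInftySat (κ.restrictOfFinrankEqTwo hp K hK2) (GreenbergSelmer.Cofree θ (padicCoeffField S)) ↥(padicCoeffIntegers S) (W.baseChange K) j {w : HeightOneSpectrum (𝓞 K) | ∃ v ∈ S₀, ((natGenerator v : ℕ) : 𝓞 K) ∈ w.asIdeal} ε),
      Dψ.toDual (letI := instX; (PowerSeries.C a₁ : IwasawaAlgebraO S) • x) s₁ =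
        Dψ.toDual x ⟨GreenbergSelmer.scalarH1 _ _ a₁ s₁,
          SmallImageCharSignedSelmer.scalarH1_mem_signedTransportSelmerInftySat _ _ ↥(padicCoeffIntegers S) (W.baseChange K) j {w : HeightOneSpectrum (𝓞 K) | ∃ v ∈ S₀, ((natGenerator v : ℕ) : 𝓞 K) ∈ w.asIdeal} ε a₁ s₁.2⟩)
    (hCQ : ∀ (a₁ : ↥(padicCoeffIntegers S)) (x : DQ.X) (c : SmallImageRttD2Seq.localCondInftySat (κ.restrictOfFinrankEqTwo hp K hK2) (GreenbergSelmer.Cofree θ (padicCoeffField S)) ↥(padicCoeffIntegers S) (W.baseChange K) j ε vp),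
      DQ.toDual (letI := instQ; (PowerSeries.C a₁ : IwasawaAlgebraO S) • x) c =
        DQ.toDual x (SmallImageRttD2Seq.scalarLocalSat _ _ ↥(padicCoeffIntegers S) (W.baseChange K) j ε vp a₁ c))
    (hγB : γK⁻¹ * resGalOfEmb (closureEmb (K := K) (vp.adicCompletion K)) γv ∈ (κ.restrictOfFinrankEqTwo hp K hK2).kerSubgroup),
    letI := instX; letI := instQ
    haveI : IsScalarTower (IwasawaAlgebra p) (IwasawaAlgebraO S) Dψ.X :=
      SmallImageRttCharRoad.isScalarTower_iwasawaAlgebraO_of_smul_eq S (fun _ ↦ rfl) hιX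
    haveI : IsScalarTower (IwasawaAlgebra p) (IwasawaAlgebraO S) DQ.X :=
      SmallImageRttCharRoad.isScalarTower_iwasawaAlgebraO_of_smul_eq S (fun _ ↦ rfl) hιQ
    let gX := SmallImageRttD2Seq.gXLinearMapO S Dψ DQ (fun _ _ ↦ rfl) (SmallImageRttD2Seq.natCast_mem_asIdeal_of_eq_span hv) instX instQ hιX hιQ hCX hCQ
          (GreenbergSelmer.exists_pow_smul_cofree_eq_zero S θ) (GreenbergSelmer.isOpen_stabilizer_cofree S θ)
          (SmallImageRttD2Seq.isOpen_stabilizer_of_hres (GreenbergSelmer.Cofree θ (padicCoeffField S)) vp (fun _ _ ↦ rfl)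
            (GreenbergSelmer.isOpen_stabilizer_cofree S θ)) hγK
          (SmallImageRttD2Seq.isNonsplitIn_restrictOfFinrankEqTwo hp hκ K hK2 hnd (SmallImageRttD2Seq.natCast_mem_asIdeal_of_eq_span hv)) hγv;
    ∀ jv : I.H →ₗ[IwasawaAlgebraO S] DQ.X,
      (∀ b : I.H, DQ.toDual (jv b) =
        ((SmallImageRttD2Seq.layerPairingOf S (κ.restrictOfFinrankEqTwo hp K hK2) θ' (Literature.NumberTheory.ComplexMultiplication.EllipticUnits.JohnsonLeungKings2011.suppPF p 𝔣) vp
            (GreenbergSelmer.Cofree θ (padicCoeffField S))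
            (SmallImageRttD2Seq.isOpen_stabilizer_of_hres (GreenbergSelmer.Cofree θ (padicCoeffField S)) vp (fun _ _ ↦ rfl) (GreenbergSelmer.isOpen_stabilizer_cofree S θ))
            (SmallImageRttD2Seq.cofreeLamCoeffPairing S lam hlam θ' (Literature.NumberTheory.ComplexMultiplication.EllipticUnits.JohnsonLeungKings2011.suppPF p 𝔣) vp θ (fun _ _ ↦ rfl)
              (SmallImageRttD2Seq.isOpen_stabilizer_of_hres (GreenbergSelmer.Cofree θ (padicCoeffField S)) vp (fun _ _ ↦ rfl) (GreenbergSelmer.isOpen_stabilizer_cofree S θ)) hθ'θ)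
            (GreenbergSelmer.exists_pow_smul_cofree_eq_zero S θ) γK⁻¹ γv hγB hNP
            (SmallImageRttD2Seq.isNonsplitIn_restrictOfFinrankEqTwo hp hκ K hK2 hnd (SmallImageRttD2Seq.natCast_mem_asIdeal_of_eq_span hv))
            (SmallImageRttD2Seq.cofreeLamCoeffPairing_hPred S lam hlam θ' (Literature.NumberTheory.ComplexMultiplication.EllipticUnits.JohnsonLeungKings2011.suppPF p 𝔣) vp θ (fun _ _ ↦ rfl)
              (SmallImageRttD2Seq.isOpen_stabilizer_of_hres (GreenbergSelmer.Cofree θ (padicCoeffField S)) vp (fun _ _ ↦ rfl) (GreenbergSelmer.isOpen_stabilizer_cofree S θ)) hθ'θ)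
            (SmallImageRttD2Seq.cofreeLamCoeffPairing_hPsc S lam hlam θ' (Literature.NumberTheory.ComplexMultiplication.EllipticUnits.JohnsonLeungKings2011.suppPF p 𝔣) vp θ (fun _ _ ↦ rfl)
              (SmallImageRttD2Seq.isOpen_stabilizer_of_hres (GreenbergSelmer.Cofree θ (padicCoeffField S)) vp (fun _ _ ↦ rfl) (GreenbergSelmer.isOpen_stabilizer_cofree S θ)) hθ'θ)).towerPairing I).pairing
          (SmallImageRttD2Seq.isOpen_stabilizer_of_hres (GreenbergSelmer.Cofree θ (padicCoeffField S)) vp (fun _ _ ↦ rfl) (GreenbergSelmer.isOpen_stabilizer_cofree S θ)) b) →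
      Function.Exact (jv ∘ₗ (SmallImageRttD2Seq.strictCarrier I (SmallImageRttD2Seq.strictLevel S (κ.restrictOfFinrankEqTwo hp K hK2) θ' (Literature.NumberTheory.ComplexMultiplication.EllipticUnits.JohnsonLeungKings2011.suppPF p 𝔣) {w : HeightOneSpectrum (𝓞 K) | ∃ v ∈ S₀, ((natGenerator v : ℕ) : 𝓞 K) ∈ w.asIdeal})
        (fun n k f _ hy ↦ SmallImageRttD2Seq.smul_mem_strictLevel S (κ.restrictOfFinrankEqTwo hp K hK2) θ' (Literature.NumberTheory.ComplexMultiplication.EllipticUnits.JohnsonLeungKings2011.suppPF p 𝔣) {w : HeightOneSpectrum (𝓞 K) | ∃ v ∈ S₀, ((natGenerator v : ℕ) : 𝓞 K) ∈ w.asIdeal} γK⁻¹ n k f hy)).subtype) gX := by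
  letI := localAction (closureEmb (K := K) (vp.adicCompletion K)) (Cofree θ (padicCoeffField S))
  haveI := smulCommClass_localAction (R := padicCoeffIntegers S) (Cofree θ (padicCoeffField S)) vp
  haveI : FiniteDimensional ℚ_[p] (padicCoeffField S) := Module.finite_of_finrank_pos hS
  haveI := htc
  intro lam hlam hinj hsurj γv hγv DQ instX instQ hιX hιQ hCX hCQ hγB gX jv hjv
  exact exact_junctionMap_comp_subtype_cofree_lam_of_lamPerfect S lam hlam θ Dψ DQ (fun _ _ ↦ rfl) (natCast_mem_asIdeal_of_eq_span hv) I
    (isOpen_stabilizer_of_hres (Cofree θ (padicCoeffField S)) vp (fun _ _ ↦ rfl) (GreenbergSelmer.isOpen_stabilizer_cofree S θ)) hθ'θ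
    (GreenbergSelmer.exists_pow_smul_cofree_eq_zero S θ) hγB hNP
    (isNonsplitIn_restrictOfFinrankEqTwo hp hκ K hK2 hnd (natCast_mem_asIdeal_of_eq_span hv)) rfl instX instQ hιX hιQ hCX hCQ
    (GreenbergSelmer.isOpen_stabilizer_cofree S θ) hγK hγv (finite_suppPF_of_ne_bot h𝔣) (finite_placesAboveFinset S₀)
    (eq_of_mem_suppPF_of_not_mem_placesAboveFinset S θ W S₀ hS₀bad hbad hθunr hv hθ'θ hR) (eq_of_natCast_mem_asIdeal_of_eq_span hv)
    (forall_smul_cofree_eq_of_frameSupp S θ hθ'θ hU) (not_mem_placesAboveFinset_of_eq_span S₀ hS₀p hv) (mem_suppPF_of_eq_span 𝔣 hv)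
    (frame_eq_one_of_mem_ramificationSubgroup S hU) hinj hsurj jv hjv

end Summit.BirchSwinnertonDyer.BirchSwinnertonDyer.Theorems.SmallImageRttD2Seq

end
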